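import Summits.ResolutionOfSingularities.ResolutionOfSingularities.Theorems.FrobeniusClosingPatchingRelPerfectDepthPhaseCContactEndSncLift
import Summits.ResolutionOfSingularities.ResolutionOfSingularities.Theorems.FrobeniusClosingPatchingRelPerfectDepthSncLocusOpen
import HarnessLib

/-!
# Crux `PatchingRelPerfect` (stmt-ResolutionOfSingularities-16161), chain W5.2 — F7(β) (β-AX) X3 C-I (M2b-T) (T-c), open form:
# the SNC LIFT holds on an OPEN NEIGHBOURHOOD of the carrier (no `hoff`) on a Noetherian quasi-excellent scheme

[OURS · L1 W5.2 · F7(β) (β-AX) X3 C-I (M2b-T) (T-c) · res-D-pv-034 AS res-L1-s36-pv-3 per DESK WORD 20:05:57Z, tri-2 21:01:44Z /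
my 21:03:31Z.]  Replaces the role of NO printed item; NOT a statement of the manuscript under review; fact-free, def-free.  AI-written;
AI review is weaker than expert review.

`hasSNC_cons_at_of_traces` (`…ContactEndSncLift`, p566997) gives the snc condition of `G :: 𝓛` AT the points of `V(G)`; res-D-pv-046's
`DepthSNC.exists_isOpen_forall_sncWithAt'` (`…DepthSncLocusOpen`, the snc-with locus is OPEN on a Noetherian quasi-excellent scheme)
spreads it to an open `U ⊇ V(G)`; restricting along `U.ι` gives `HasSNC ((G :: 𝓛)|_U)` — the `hsnc` binder of
`carrierGameLift_of_ambientLetters` on the patch `U`, with NO hypothesis off the carrier.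

* `DepthSNC.SNCWithAt.comap_opens_ι` — `SNCWithAt E ⊤ (U.ι y) ⇒ SNCWithAt (E|_U) ⊤ y` (transport along the stalk isomorphism);
* `hasSNC_map_comap_ι_of_forall_sncWithAt` — pointwise on an open ⇒ `HasSNC` of the restricted list;
* **`exists_open_hasSNC_cons_of_traces`**.
-/

-- `Summit.<Summit>.<Sub>.Theorems` with `Sub = Summit` (single-conjunct summit, D-0017)
set_option linter.dupNamespace false

noncomputable section

open CategoryTheory AlgebraicGeometry TopologicalSpace IsLocalRing
open Literature.AlgebraicGeometry.Resolution
open Scheme.IdealSheafData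

namespace Summit.ResolutionOfSingularities.ResolutionOfSingularities.Theorems

universe u

variable {X : Scheme.{u}}

/-- **`SNCWithAt` restricts along the inclusion of an open**: transport the adapted regular system of parameters along
`𝒪_{X,y} ≅ 𝒪_{U,y}`. [folklore] -/
theorem DepthSNC.SNCWithAt.comap_opens_ι (E : List X.IdealSheafData) (U : X.Opens) (y : U)
    (h : DepthSNC.SNCWithAt E ⊤ (U.ι y)) : DepthSNC.SNCWithAt (E.map fun D => D.comap U.ι) ⊤ y := by
  classical
  obtain ⟨hreg, d, v, hd, hv, ⟨ι, hι, hD⟩, -⟩ := h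
  haveI := hreg
  let e : X.presheaf.stalk (U.ι y) ≃+* (U : Scheme.{u}).presheaf.stalk y := (asIso (U.ι.stalkMap y)).commRingCatIsoToRingEquiv
  haveI hreg' : IsRegularLocalRing ((U : Scheme.{u}).presheaf.stalk y) := IsRegularLocalRing.of_ringEquiv e
  have htop : ∀ z : (U : Scheme.{u}), z ∉ (⊤ : (U : Scheme.{u}).IdealSheafData).support := fun z hz => by
    have h' : z ∈ ((⊤ : (U : Scheme.{u}).IdealSheafData).support : Set U) := hz
    simp [Scheme.IdealSheafData.support_top] at h'
  -- the dimension count transports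
  have hd' : (maximalIdeal ((U : Scheme.{u}).presheaf.stalk y)).spanFinrank = d := by
    rw [← hd]
    have h1 := IsRegularLocalRing.spanFinrank_maximalIdeal (R := (U : Scheme.{u}).presheaf.stalk y)
    have h2 := IsRegularLocalRing.spanFinrank_maximalIdeal (R := X.presheaf.stalk (U.ι y))
    have h3 := ringKrullDim_eq_of_ringEquiv e
    have h : ((maximalIdeal ((U : Scheme.{u}).presheaf.stalk y)).spanFinrank : WithBot ℕ∞) =
        (maximalIdeal (X.presheaf.stalk (U.ι y))).spanFinrank := by rw [h1, h2, h3]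
    exact_mod_cast h
  -- members of the restricted list through `y` come from members through `U.ι y`
  have hpre : ∀ D' : {D' // D' ∈ E.map (fun D => D.comap U.ι) ∧ y ∈ D'.support},
      ∃ D : {D // D ∈ E ∧ U.ι y ∈ D.support}, D.1.comap U.ι = D'.1 := fun D' => by
    obtain ⟨D, hDE, hDD'⟩ := List.mem_map.mp D'.2.1
    refine ⟨⟨D, hDE, ?_⟩, hDD'⟩
    have hy := D'.2.2
    rw [← hDD', support_comap] at hy
    exact hy
  choose pre hpre' using hpre
  refine ⟨hreg', d, fun i => e (v i), hd', ?_, ⟨fun D' => ι (pre D'), fun D₁ D₂ h12 => ?_, fun D' => ?_⟩, fun h => absurd h (htop y)⟩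
  · rw [show (Set.range fun i => e (v i)) = (e : _ →+* _) '' Set.range v from (Set.range_comp _ _), ← Ideal.map_span, hv]
    exact DepthSNC.map_maximalIdeal_of_ringEquiv e
  · have h := hι h12
    exact Subtype.ext (by rw [← hpre' D₁, ← hpre' D₂, h])
  · rw [← hpre' D', stalkIdeal_comap_eq_map_stalkMap, hD (pre D'), Ideal.map_span, Set.image_singleton]
    rfl

/-- **Pointwise snc on an open ⇒ `HasSNC` of the restricted list.** [folklore] -/
theorem hasSNC_map_comap_ι_of_forall_sncWithAt (E : List X.IdealSheafData) (U : X.Opens)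
    (h : ∀ y ∈ (U : Set X), DepthSNC.SNCWithAt E ⊤ y) : HasSNC (E.map fun D => D.comap U.ι) :=
  DepthSNC.hasSNCWith_of_forall_sncWithAt fun y => DepthSNC.SNCWithAt.comap_opens_ι E U y (h _ y.2)

namespace DepthMultiHost

variable [IsNoetherian X]

/-- [OURS · L1 W5.2 · (T-c) open form] **The SNC LIFT holds on an open neighbourhood of the carrier, with no hypothesis off the
carrier**, on a Noetherian quasi-excellent regular scheme: traces snc on `V(G)` + principal separated letter stalks ⇒
`∃ U ⊇ V(G)` open with `HasSNC ((G :: 𝓛)|_U)`. [cite: Matsumura1987, Thm. 14.2 and §32 p. 260] [cite: Kollar2007, Cor. 3.85] -/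
theorem exists_open_hasSNC_cons_of_traces (hX : Scheme.IsRegular X) (hXq : Scheme.IsQuasiExcellent X) (G : X.IdealSheafData)
    (hGhyp : ∀ x ∈ G.support, ∃ v : X.presheaf.stalk x,
      stalkIdeal G x = Ideal.span {v} ∧ v ∉ (maximalIdeal (X.presheaf.stalk x)) ^ 2)
    (𝓛 : List X.IdealSheafData)
    (hL : ∀ L ∈ 𝓛, ∀ x ∈ G.support, x ∈ L.support → ∃ f : X.presheaf.stalk x, stalkIdeal L x = Ideal.span {f})
    (hsep : ∀ L ∈ 𝓛, ∀ L' ∈ 𝓛, ∀ x ∈ G.support, x ∈ L.support → x ∈ L'.support →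
      stalkIdeal L x ⊔ stalkIdeal G x = stalkIdeal L' x ⊔ stalkIdeal G x → L = L')
    (htr : HasSNC (𝓛.map fun L => L.comap G.subschemeι)) :
    ∃ U : X.Opens, (G.support : Set X) ⊆ (U : Set X) ∧ HasSNC ((G :: 𝓛).map fun D => D.comap U.ι) := by
  have hat : ∀ x ∈ (G.support : Set X), DepthSNC.SNCWithAt (G :: 𝓛) ⊤ x := by
    intro x hx
    obtain ⟨hreg, u, hu, ι, hι, hD⟩ := hasSNC_cons_at_of_traces hX G hGhyp 𝓛 hL hsep htr x hx
    refine ⟨hreg, _, u, rfl, hu, ⟨ι, hι, hD⟩, fun h => absurd h ?_⟩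
    intro h'
    have h'' : x ∈ ((⊤ : X.IdealSheafData).support : Set X) := h'
    simp [Scheme.IdealSheafData.support_top] at h''
  obtain ⟨U, hGU, hU⟩ := DepthSNC.exists_isOpen_forall_sncWithAt' hXq (G :: 𝓛) hat
  exact ⟨U, hGU, hasSNC_map_comap_ι_of_forall_sncWithAt _ U hU⟩

end DepthMultiHost

end Summit.ResolutionOfSingularities.ResolutionOfSingularities.Theorems

end
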